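import Summits.ResolutionOfSingularities.ResolutionOfSingularities.Theorems.FrobeniusClosingSteerWords09SteeredRegime
import Summits.ResolutionOfSingularities.ResolutionOfSingularities.Theorems.FrobeniusClosingSteerDivisorTriggerTwo
import Summits.ResolutionOfSingularities.ResolutionOfSingularities.Theorems.FrobeniusClosingSteerHighPointStepDecompositionTwo
import Summits.ResolutionOfSingularities.ResolutionOfSingularities.Theorems.FrobeniusClosingSteerNoEquimultiplePlaneTwo
import Summits.ResolutionOfSingularities.ResolutionOfSingularities.Theorems.FrobeniusClosingSteerNoHeightOneCarrierTwo
import Summits.ResolutionOfSingularities.ResolutionOfSingularities.Theorems.FrobeniusClosingSteerPersistentExcParamDiscrete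
import Summits.ResolutionOfSingularities.ResolutionOfSingularities.Theorems.FrobeniusClosingSteerRankFourExitTwo
import Summits.ResolutionOfSingularities.ResolutionOfSingularities.Theorems.FrobeniusClosingSteerSwitchPlaneTwo
import Summits.ResolutionOfSingularities.ResolutionOfSingularities.Theorems.FrobeniusClosingSteerOrderRaising

/-!
# Crux `Steer` (stmt-ResolutionOfSingularities-16345), line `switching-dichotomy` — WORDS 10: §σ2.16–§σ2.21 (part 1) of the p = 2 σ_top-STEERED COMPOSITION — res-L0-w41-strat-2's delta rev 13 IN HYPOTHESIS FORM (the B-slate Props `NoHeightOneCarrierTwo` / `RankFourExitTwo` / `HighPointStepDecompositionTwo` / `SwitchPlaneOfDecompositionTwo` / `NoEquimultiplePlanePointStepTwo`, `divisorTrigger_two`, `switch_plane_two` … `pointTailHighConclTwo_of_hygiene` and the landed B-leaves) (HOIST of the registered skeleton r38 cc5f2c8f0939be83, l.769–1119, inside `section SteeredTwo`)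

Holder res-L0-w41-lead-1 g5 on res-L0-w41-plan-1 RULING 47 (E1) / 104b; see `…Words01Core` for the hoist protocol (bodies byte for byte;
`[cite: …]` / `[folklore]` tags on CLOSED `def … : Prop` words are written «(ref. …)» / «(folklore)» — GATE NOTE of `…Words02Stubs`;
cite keys inside `[cite:]` tags normalised to `references.bib` keys where needed, as in `…Words03Phases`).
Nothing here is a statement of the manuscript [claim: Hironaka2017, status: under-review]. OURS (candidates / vocabulary; AI review is
weaker than expert review).
-/

open Summit.ResolutionOfSingularities.ResolutionOfSingularities.Theses.FrobeniusClosing (IsolatedForcedTermination)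
open Literature.AlgebraicGeometry.Resolution (IsAbhyankarPlace FGOver exists_ringKrullDim_eq_and_trdeg_eq
  trdeg_eq_trdeg_of_isFractionRing locAtCentre IsQuadraticTransformAlong SubringDominates IsRsopPart
  LocalUniformization3 RelLocalUniformization CossartPiltant2019General)
open Summit.ResolutionOfSingularities.ResolutionOfSingularities.Theorems.SteerRankThinness
  (HasProperCoarsening concl_of_hasProperCoarsening rankOne_of_not_hasProperCoarsening)
open Summit.ResolutionOfSingularities.ResolutionOfSingularities.Theorems.PfaffLine

set_option linter.dupNamespace false

namespace Summit.ResolutionOfSingularities.ResolutionOfSingularities.Theorems.SwitchingDichotomy.Words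

section SteeredTwo

open IsLocalRing
open Literature.AlgebraicGeometry.Resolution (IsLocalBlowupAlong IsQuadraticTransform IsExcellentRing)

variable {K : Type} [Field K]


/-! ### §σ2.16–§σ2.21 (res-L0-w41-strat-2's delta rev 13 r24-native f48d54d7a8314174, pasted by the holder at r25 IN HYPOTHESIS FORM
(plan-1 RULING 9/15: the five sorried one-step lemmas B4 / B7 / B13a-1′ / B13a-1″ / B13a-2 become the Props `NoHeightOneCarrierTwo` /
`RankFourExitTwo` / `HighPointStepDecompositionTwo` / `SwitchPlaneOfDecompositionTwo` / `NoEquimultiplePlanePointStepTwo` — binders and conclusions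
VERBATIM — threaded as explicit hypotheses of `switch_plane_two` / `highPointStep_excParam_persists_two` / `pointTailHigh_discrete_two` /
`pointTailHighConclTwo_of_hygiene`; every other line is strat-2's text verbatim). §σ2.16 (res-L0-w41-strat-2, CRUX-STRATEGIST; plan-1 06:56:20Z ask «type B1 and B7 as sorry stubs over r22 + delta vocabulary»):
the FIRST DISCHARGEABLE ONE-STEP LEMMAS of the two regime halves — B1 `divisorTrigger_two`, B4 `noHeightOneCarrier_two` (HIGH) and B7 `rankFour_exit_two` (LOW) — plus one
derived corollary. Helper-leaf CANDIDATES (the holder decides what enters the skeleton; proofs land Theses-free `--supports 16345 --as helper`).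
Hypotheses `hreg`/`hreg'` ⇐ M `SteeredMembersRegular` (p501181); `hdim` ⇐ `TailCodimBound`'s dimension count; `hirr` (the generic torsor fibre is a
field: `s j ∉ Frac (R j)`) ⇐ `CoreDatum`'s non-`p`-th-power row + normality of the members; `hperf` (residue constants are squares mod `𝔪`) ⇐
`PerfectField k` + `ZeroDim`. Characteristic 2 is USED in both (in odd characteristic `T² = 1 + x₀²` is regular over the divisor, and the
polar form does not classify quadratic forms mod squares). OURS; candidates, not facts. [STRAT2-MEMO-1 §3 B1, §4b B7 = idea-3 «hyperbolic-splitting-p2» (i)/(iv)] -/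

/-- **B1 · divisor trigger (HIGH half; stub, S–M).** At a POINT stage `i` of a 2-steered run, if SOME cleaning of the radicand lies in `𝔪ᵢ⁴`, then
σ_top does NOT take the point at stage `i + 1`: the exceptional prime `(x₀) ⊂ R (i+1)` is σ_top-permissible — singular since `f' − G² ∈ (x₀)²` with
`G = (ĝ − g₀)/x₀` (`ĝ − g₀ ∈ 𝔪ᵢ` because `(ĝ − g₀)² ∈ x₀² R (i+1) ∩ R i = 𝔪ᵢ²`), minimal among singular primes since the generic torsor fibre is a
field (`hirr`), top-dimensional since `dim R/(x₀) = dim R − 1`, and `R/(x₀)` regular (exceptional divisor of the blow-up of a regular local ring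
at its closed point). OURS. -/
theorem divisorTrigger_two [CharP K 2] (O : ValuationSubring K) (R : ℕ → Subring K) (P : (i : ℕ) → Ideal (R i))
    (t : K) (s : ℕ → K) (hrun : IsSteeredRun O R P t 2 s) (i : ℕ)
    (hR : ∀ j, ∃ B : Subring K, B ≤ O.toSubring ∧ R j = locAtCentre B O)
    (hreg : IsRegularLocalRing (R i)) (hreg' : IsRegularLocalRing (R (i + 1)))
    (hdim : ringKrullDim (R (i + 1)) = 4)
    (hirr : ∀ y z : R (i + 1), (z : K) ≠ 0 → s (i + 1) * z ≠ y)
    (hpt : IsPointStep R P i)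
    (h4 : ∃ (_ : IsLocalRing (R i)) (hs : s i ^ 2 ∈ R i) (g : R i),
      (⟨s i ^ 2, hs⟩ : R i) - g ^ 2 ∈ maximalIdeal (R i) ^ 4) :
    ¬ IsPointStep R P (i + 1) := by
  -- ADOPTION LEAF (res-D-pv-011 AS stub-7, p510711 + p511662 LANDED; leaf kernel-checked by pv-011 on c6800afd23d786b8, VERBATIM)
  rintro ⟨hloc', hP'⟩
  obtain ⟨hloc, hs, -, hbl, x, g, hx, hg, hstep⟩ := hrun.2 i
  obtain ⟨hloc₁, hs', hσ', -, -⟩ := hrun.2 (i + 1)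
  obtain ⟨_, hPi⟩ := hpt
  obtain ⟨_, hs₀, g₀, hg₀⟩ := h4
  have hdomi : Literature.AlgebraicGeometry.Resolution.SubringDominates (R i) O.toSubring := by
    obtain ⟨B, hB, e⟩ := hR i
    rw [e]
    exact Literature.AlgebraicGeometry.Resolution.subringDominates_locAtCentre hB
  rw [hPi] at hbl hx
  obtain ⟨hxR', hperm⟩ :=
    Summit.ResolutionOfSingularities.ResolutionOfSingularities.Theorems.SwitchingDichotomy.DivisorTrigger.exceptional_isPermissibleCentre
      O hdomi hbl hreg hreg' hdim (by norm_num) hx hg hstep hs hs' ⟨g₀, hg₀⟩ hirr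
  exact Summit.ResolutionOfSingularities.ResolutionOfSingularities.Theorems.SwitchingDichotomy.DivisorTrigger.ne_maximalIdeal_of_sigmaTop
    (Perm := fun Q => IsPermissibleCentre (R (i + 1)) 2 ⟨s (i + 1) ^ 2, hs'⟩ Q) hperm (fun Q h => h.1) hσ' hP'

/-- **Corollary of B1 (derived, no new sorry)**: on a POINT TAIL of a 2-steered run no cleaning ever reaches `𝔪ᵢ⁴` — the cleaned order is 2 or 3 at
every stage of the tail (§σ2.10's «order exactly 2» is not automatic: order-3 point stages with carriers `P ⊆ 𝔪ᵢ²` or isolated singular locus are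
a priori possible, STRAT2-MEMO-1 §3 B3 / §4c). OURS. -/
theorem pointTail_cleanedOrder_le_three [CharP K 2] (O : ValuationSubring K) (R : ℕ → Subring K)
    (P : (i : ℕ) → Ideal (R i)) (t : K) (s : ℕ → K) (hrun : IsSteeredRun O R P t 2 s)
    (hR : ∀ j, ∃ B : Subring K, B ≤ O.toSubring ∧ R j = locAtCentre B O)
    (hreg : ∀ i, IsRegularLocalRing (R i)) (hdim : ∀ i, ringKrullDim (R i) = 4)
    (hirr : ∀ i, ∀ y z : R i, (z : K) ≠ 0 → s i * z ≠ y)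
    (i₀ : ℕ) (hpt : ∀ i, i₀ ≤ i → IsPointStep R P i) :
    ∀ i, i₀ ≤ i → ¬ ∃ (_ : IsLocalRing (R i)) (hs : s i ^ 2 ∈ R i) (g : R i),
      (⟨s i ^ 2, hs⟩ : R i) - g ^ 2 ∈ maximalIdeal (R i) ^ 4 := by
  intro i hi h4
  exact divisorTrigger_two O R P t s hrun i hR (hreg i) (hreg (i + 1)) (hdim (i + 1)) (hirr (i + 1)) (hpt i hi) h4
    (hpt (i + 1) (Nat.le_succ_of_le hi))

/-- **B4 · no height-one carrier on a point tail (HIGH half; stub, M).** If stages `i` and `i + 1` of a 2-steered run are both point steps, then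
NO height-one prime of `R i` is singular for the radicand. For a singular height-one prime `(u)` (char 2, `R i` a UFD): `f ≡ g'² (mod u² R_{(u)})`
for some LOCAL `g'`, hence every derivation kills `f` modulo `(u²)` (`∂(g'²) = 0`, `∂(u² e) = u² ∂e`), i.e. `J(f) ⊆ (u)^{(2)} = (u²)`. If `u ∉ 𝔪ᵢ²`
then `R/(u)` is regular (normal), `f̄ ∈ Frac(R/(u))² ∩ R/(u) = (R/(u))²` gives a GLOBAL `g` with `f − g² ∈ (u²)`, and `(u)` is σ_top-permissible
(singular, minimal by `hirr`, top-dimensional, regular) — contradicting the point step at `i`; if `u ∈ 𝔪ᵢ²` then `J(f) ⊆ 𝔪ᵢ⁴`, so the non-square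
part of `f` (perfect coefficient field) has order ≥ 5 and B1 fires at `i + 1`. OURS. [STRAT2-MEMO-1 §3 B4, sharpened] -/
def NoHeightOneCarrierTwo : Prop :=
  ∀ {K : Type} [Field K] [CharP K 2] (O : ValuationSubring K) (R : ℕ → Subring K) (P : (i : ℕ) → Ideal (R i))
    (t : K) (s : ℕ → K) (_hrun : IsSteeredRun O R P t 2 s) (i : ℕ)
    (_hR : ∀ j, ∃ B : Subring K, B ≤ O.toSubring ∧ R j = locAtCentre B O)
    (_hreg : IsRegularLocalRing (R i)) (_hreg' : IsRegularLocalRing (R (i + 1)))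
    (_hdim : ringKrullDim (R i) = 4) (_hdim' : ringKrullDim (R (i + 1)) = 4)
    (_hperf : ∀ j, ∀ (_ : IsLocalRing (R j)) (a : R j), ∃ b : R j, a - b ^ 2 ∈ maximalIdeal (R j))
    (_hirr : ∀ j, ∀ y z : R j, (z : K) ≠ 0 → s j * z ≠ y)
    (_hpt : IsPointStep R P i) (_hpt' : IsPointStep R P (i + 1)) (hs : s i ^ 2 ∈ R i),
    ∀ (Q : Ideal (R i)) [Q.IsPrime], Q.height = 1 → ¬ IsSingPrime (R i) 2 ⟨s i ^ 2, hs⟩ Q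

/-- **B4 holds** (adoption leaf over res-type-096's LANDED p513208 / p513726 `NoHeightOneCarrier.exists_deep_witness_of_singular_heightOne`
(the regular carrier `u ∉ 𝔪ᵢ²` is σ_top-permissible — excluded by the point step at `i`; otherwise a LOCAL square root modulo `u²` with
`u ∈ 𝔪ᵢ²`), p514609 / p515764 `OrderRaising.exists_sq_sub_mem_pow_five_of_local_root` (derivative-free order raising through `R̂ᵢ ≅ κ⟦X⟧`,
Cohen + `p`-components: `f − ĝ² ∈ 𝔪ᵢ⁵`), and B1 `divisorTrigger_two` (the point step at `i + 1` is then impossible). OURS. [folklore] -/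
theorem noHeightOneCarrierTwo_holds : NoHeightOneCarrierTwo := by
  intro K _ _ O R P t s hrun i hR hreg hreg' hdim hdim' hperf hirr hpt hpt' hs Q _ hQ hsing
  obtain ⟨hloc, hs₀, hσ, -, -⟩ := hrun.2 i
  obtain ⟨_, hPi⟩ := id hpt
  haveI := hreg
  -- a point step: no positive-dimensional σ_top-permissible centre at stage `i`
  have hnoperm : ∀ Q' : Ideal (R i), ¬ IsPermissibleCentre (R i) 2 ⟨s i ^ 2, hs⟩ Q' := by
    rcases hσ with hperm | ⟨-, hno, -⟩
    · exact absurd hPi hperm.1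
    · exact hno
  -- the deep carrier and its local square root
  obtain ⟨u, a, d, hQu, hu, hu2, hd, had⟩ :=
    _root_.Summit.ResolutionOfSingularities.ResolutionOfSingularities.Theorems.SwitchingDichotomy.NoHeightOneCarrier.exists_deep_witness_of_singular_heightOne
      (R i) hdim (s i) hs (hirr i) hnoperm Q hQ hsing
  -- order raising: a cleaning of order ≥ 5
  have hd' : ¬ u ∣ d := fun h => hd (hQu ▸ Ideal.mem_span_singleton.mpr h)
  have had' : u ^ 2 ∣ d ^ 2 * (⟨s i ^ 2, hs⟩ : R i) - a ^ 2 := by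
    rw [hQu, Ideal.span_singleton_pow, Ideal.mem_span_singleton] at had
    exact had
  obtain ⟨ĝ, hĝ⟩ :=
    _root_.Summit.ResolutionOfSingularities.ResolutionOfSingularities.Theorems.SwitchingDichotomy.OrderRaising.exists_sq_sub_mem_pow_five_of_local_root
      (hperf i hloc) hu hu2 hd' had'
  -- B1: the point step at `i + 1` is impossible
  exact divisorTrigger_two O R P t s hrun i hR hreg hreg' hdim' (hirr (i + 1)) hpt
    ⟨hloc, hs, ĝ, Ideal.pow_le_pow_right (by norm_num) hĝ⟩ hpt'

/-- **B7 · full polar rank exits (LOW half; stub, M) — stated positively: at EVERY stage of a 2-steered run the cleaned quadratic part is a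
product of two elements of `𝔪ᵢ` modulo squares and `𝔪ᵢ³` (polar rank ≤ 2).** Over a perfect residue field, quadratic forms modulo squares of
linear forms ARE alternating (polar) forms, of rank 0, 2 or 4 at `n = 4`; rank 4 has trivial radical, so (i) no positive-dimensional permissible
centre exists (`f − g² ∈ P²` puts the radical above `{in₁ P = 0} ≠ 0`), and (ii) after the point step in direction `c` the radicand is
`q(c) + b_q(c, y') + …` with `b_q(c, ·) ≠ 0`: cleaned order 1, the torsor at stage `i + 1` is regular at the closed point, so σ_top has no move
there — contradicting `IsSteeredRun` at `i + 1`. (= idea-3 «hyperbolic-splitting-p2» (i)/(iv), prior; W4.6 `even_rank_polarMatrix` family.) OURS. -/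
def RankFourExitTwo : Prop :=
  ∀ {K : Type} [Field K] [CharP K 2] (O : ValuationSubring K) (R : ℕ → Subring K) (P : (i : ℕ) → Ideal (R i))
    (t : K) (s : ℕ → K) (_hrun : IsSteeredRun O R P t 2 s) (i : ℕ)
    (_hR : ∀ j, ∃ B : Subring K, B ≤ O.toSubring ∧ R j = locAtCentre B O)
    (_hreg : IsRegularLocalRing (R i)) (_hreg' : IsRegularLocalRing (R (i + 1)))
    (_hdim : ringKrullDim (R i) = 4) (_hdim' : ringKrullDim (R (i + 1)) = 4)
    (_hperf : ∀ j, ∀ (_ : IsLocalRing (R j)) (a : R j), ∃ b : R j, a - b ^ 2 ∈ maximalIdeal (R j))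
    (_hirr : ∀ y z : R (i + 1), (z : K) ≠ 0 → s (i + 1) * z ≠ y),
    ∃ (_ : IsLocalRing (R i)) (hs : s i ^ 2 ∈ R i) (g z w : R i), z ∈ maximalIdeal (R i) ∧ w ∈ maximalIdeal (R i) ∧
      (⟨s i ^ 2, hs⟩ : R i) - g ^ 2 - z * w ∈ maximalIdeal (R i) ^ 3

/-- **B7 holds** (adoption leaf over res-L0-w41-stub-3's six LANDED files p509947 … p515262, `RankFourExit.rankFour_exit_two`; stub-3's
slot-tested text 08:46:42Z). OURS. [folklore] -/
theorem rankFourExitTwo_holds : RankFourExitTwo := fun O R P _t s hrun i hR hreg hreg' hdim hdim' hperf _ =>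
  _root_.Summit.ResolutionOfSingularities.ResolutionOfSingularities.Theorems.SwitchingDichotomy.RankFourExit.rankFour_exit_two
    (fun S _ f Q => IsPermissibleCentre S 2 f Q) (fun _ _ _ _ h => ⟨h.1, h.2.1.fst, h.2.2.2⟩) O R P s hrun.2 i hR hreg hreg' hdim
    hdim' hperf

/-- **B13a-1′ · HIGH POINT-STEP DECOMPOSITION** (OURS, strat-2 07:55Z; the D1 half of B13a-1, size S; char 2, point blow-up algebra):
a point step at `i` with HIGH order at `i` and `i+1` puts the next radicand in the shape `f_{i+1} = x·ρ + G²` with `ρ ∈ 𝔪_{i+1}²`, for ANY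
exceptional parameter `x` of stage `i` (which is a regular parameter of `R (i+1)`: `x ∈ 𝔪_{i+1} ∖ 𝔪_{i+1}²`, the exceptional divisor being
regular). Computation: `f_{i+1} = (f_i − g²)/x² = (f_i − ĝ²)/x² + ((ĝ − g)/x)²` with `f_i − ĝ² ∈ 𝔪_i³ ⊆ x³R_{i+1}` (HIGH at `i`), the second
summand integral hence in `R (i+1)` (normality); HIGH at `i+1` then forces `ρ ∈ 𝔪²` after moving a multiple of `x²` into the square (graded
lemma: `w ∈ 𝔪 ∖ 𝔪²`, `xρ₀ + w² ∈ 𝔪³` ⇒ `w ≡ μx mod 𝔪²`). Also the first structural fact of the HIGH-wander reading (§σ2.18): after a HIGH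
point step the radicand is divisible by the exceptional divisor modulo squares. (folklore) -/
def HighPointStepDecompositionTwo : Prop :=
  ∀ {K : Type} [Field K] [CharP K 2]
    (O : ValuationSubring K) (R : ℕ → Subring K) (P : (i : ℕ) → Ideal (R i)) (t : K) (s : ℕ → K)
    (_hrun : IsSteeredRun O R P t 2 s) (i : ℕ)
    (_hR : ∀ j, ∃ B : Subring K, B ≤ O.toSubring ∧ R j = locAtCentre B O)
    (_hreg : ∀ j, IsRegularLocalRing (R j)) (_hdim : ∀ j, ringKrullDim (R j) = 4)
    (_hpt : IsPointStep R P i) (_hhigh : IsHighOrderAt R s 2 i) (_hhigh' : IsHighOrderAt R s 2 (i + 1))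
    (x : K) (_hx : IsExcParamAlong O (R i) (P i) x),
    ∃ (_ : IsLocalRing (R (i + 1))) (hs : s (i + 1) ^ 2 ∈ R (i + 1)) (hx₁ : x ∈ R (i + 1)) (ρ G : R (i + 1)),
      ρ ∈ maximalIdeal (R (i + 1)) ^ 2 ∧ (⟨x, hx₁⟩ : R (i + 1)) ∈ maximalIdeal (R (i + 1)) ∧
        (⟨x, hx₁⟩ : R (i + 1)) ∉ maximalIdeal (R (i + 1)) ^ 2 ∧
        (⟨s (i + 1) ^ 2, hs⟩ : R (i + 1)) = ⟨x, hx₁⟩ * ρ + G ^ 2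

/-- **B13a-1′ holds** (adoption leaf over res-type-076's LANDED p513210 `HighPointStep.highPointStep_decomposition_pointStep`; 076's
12-line adapter text 08:17:38Z, binders `hdim`, `t` idle). OURS. [folklore] -/
theorem highPointStepDecompositionTwo_holds : HighPointStepDecompositionTwo := by
  intro K _ _ O R P t s hrun i hR hreg _hdim hpt hhigh hhigh' x hx
  obtain ⟨hloc, -, -, hbl, hstrict⟩ := hrun.2 i
  obtain ⟨hloc', -⟩ := hrun.2 (i + 1)
  obtain ⟨_, hPi⟩ := hpt
  obtain ⟨_, hs, g, hg⟩ := hhigh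
  obtain ⟨_, hs', g', hg'⟩ := hhigh'
  unfold IsStrictStepAlong IsExcParamAlong at hstrict
  unfold IsExcParamAlong at hx
  rw [hPi] at hbl hstrict hx
  obtain ⟨hs'', hx₁, ρ, G, h⟩ :=
    _root_.Summit.ResolutionOfSingularities.ResolutionOfSingularities.Theorems.SwitchingDichotomy.HighPointStep.highPointStep_decomposition_pointStep
      O R s i hR hreg hbl hstrict ⟨hs, g, hg⟩ ⟨hs', g', hg'⟩ x hx
  exact ⟨hloc', hs'', hx₁, ρ, G, h⟩

/-- **B13a-1″ · A SWITCH AFTER A DECOMPOSED STAGE CREATES AN EQUIMULTIPLE REGULAR PLANE** (OURS, strat-2 07:55Z; the D2–D4 half of B13a-1,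
size S–M): if `f_{i+1} = x·ρ + G²` with `ρ ∈ 𝔪²` and `x` a regular parameter of `R (i+1)`, the step at `i+1` is a point step with exceptional
parameter `π`, and `x` is NOT of maximal value in `𝔪_{i+1}` (a switch: `v x < v π`), then in `R (i+2)` the ideal `Q = (π, x/π)` is a prime with
regular quotient of dimension 2 (`π, x/π` are part of a regular system of parameters: `R (i+2)/(π)` is the regular exceptional divisor and
`x/π` one of its coordinates, `x, π` being independent modulo `𝔪_{i+1}²` by the value inequality) and
`f_{i+2} = π·(x/π)·(ρ/π²) + ((G − g)/π)² ∈ Q² + (square)`. (folklore) -/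
def SwitchPlaneOfDecompositionTwo : Prop :=
  ∀ {K : Type} [Field K] [CharP K 2]
    (O : ValuationSubring K) (R : ℕ → Subring K) (P : (i : ℕ) → Ideal (R i)) (t : K) (s : ℕ → K)
    (_hrun : IsSteeredRun O R P t 2 s) (i : ℕ)
    (_hR : ∀ j, ∃ B : Subring K, B ≤ O.toSubring ∧ R j = locAtCentre B O)
    (_hreg : ∀ j, IsRegularLocalRing (R j)) (_hdim : ∀ j, ringKrullDim (R j) = 4)
    (_hpt : IsPointStep R P (i + 1))
    (x : K) (_hx0 : x ≠ 0) (hx₁ : x ∈ R (i + 1)) (ρ G : R (i + 1))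
    (_hρ : ∃ _ : IsLocalRing (R (i + 1)), ρ ∈ maximalIdeal (R (i + 1)) ^ 2 ∧ (⟨x, hx₁⟩ : R (i + 1)) ∈ maximalIdeal (R (i + 1)) ∧
      (⟨x, hx₁⟩ : R (i + 1)) ∉ maximalIdeal (R (i + 1)) ^ 2)
    (_hf : ∃ hs : s (i + 1) ^ 2 ∈ R (i + 1), (⟨s (i + 1) ^ 2, hs⟩ : R (i + 1)) = ⟨x, hx₁⟩ * ρ + G ^ 2)
    (_hsw : ¬ IsExcParamAlong O (R (i + 1)) (P (i + 1)) x),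
    ∃ (hs : s (i + 2) ^ 2 ∈ R (i + 2)) (Q : Ideal (R (i + 2))) (_ : Q.IsPrime) (g : R (i + 2)),
      IsRegularLocalRing (R (i + 2) ⧸ Q) ∧ ringKrullDim (R (i + 2) ⧸ Q) = 2 ∧
        (⟨s (i + 2) ^ 2, hs⟩ : R (i + 2)) - g ^ 2 ∈ Q ^ 2

/-- **B13a-1″ holds** (adoption leaf over res-type-062's LANDED p514510 `SwitchPlane.switch_plane_of_decomposition_adapter`; 062's
certified text 08:37:50Z). OURS. [folklore] -/
theorem switchPlaneOfDecompositionTwo_holds : SwitchPlaneOfDecompositionTwo := by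
  intro K _ _ O R P t s hrun i hR hreg hdim hpt x hx0 hx₁ ρ G hρ hf hsw
  obtain ⟨hl, hs, -, hbl, hst⟩ := hrun.2 (i + 1)
  obtain ⟨-, hs₂, -⟩ := hrun.2 (i + 2)
  exact _root_.Summit.ResolutionOfSingularities.ResolutionOfSingularities.Theorems.SwitchingDichotomy.SwitchPlane.switch_plane_of_decomposition_adapter
    O R P s i hR hreg hdim ⟨hl, hs, hbl, hst⟩ hpt x hx0 hx₁ ρ G hρ hf hsw hs₂

/-- **B13a-1 · SWITCH ⇒ EQUIMULTIPLE REGULAR PLANE** (OURS, strat-2 07:55Z; sub-stub of B13a, size S–M; char 2, blow-up algebra only).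
Point steps at `i, i+1, i+2`, HIGH at `i, i+1`, and an exceptional parameter `x` of stage `i` that is NO LONGER of maximal value in `𝔪_{i+1}`
(a switch) ⇒ at stage `i+2` there is a prime `Q` with `R/Q` regular of dimension 2 and a global `g` with `f_{i+2} − g² ∈ Q²` (namely
`Q = (π_{i+1}, x/π_{i+1})`, the plane `E_{i+2} ∩ E′_{i+1}`; see B13a's docstring for the computation `f_{i+1} = xρ + G₁²`, `ρ ∈ 𝔪²`,
`f_{i+2} = π_{i+1}·(x/π_{i+1})·(ρ/π_{i+1}²) + G₃²`). Uses B1 (order exactly 3) and normality of the members. [folklore] -/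
theorem switch_plane_two [CharP K 2] (hD1 : HighPointStepDecompositionTwo) (hD2 : SwitchPlaneOfDecompositionTwo)
    (O : ValuationSubring K) (R : ℕ → Subring K) (P : (i : ℕ) → Ideal (R i)) (t : K) (s : ℕ → K)
    (hrun : IsSteeredRun O R P t 2 s) (i : ℕ)
    (hR : ∀ j, ∃ B : Subring K, B ≤ O.toSubring ∧ R j = locAtCentre B O)
    (hreg : ∀ j, IsRegularLocalRing (R j)) (hdim : ∀ j, ringKrullDim (R j) = 4)
    (_hirr : ∀ j, ∀ y z : R j, (z : K) ≠ 0 → s j * z ≠ y)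
    (hpt : ∀ j, i ≤ j → j ≤ i + 2 → IsPointStep R P j)
    (hhigh : IsHighOrderAt R s 2 i) (hhigh' : IsHighOrderAt R s 2 (i + 1))
    (x : K) (hx : IsExcParamAlong O (R i) (P i) x) (hsw : ¬ IsExcParamAlong O (R (i + 1)) (P (i + 1)) x) :
    ∃ (hs : s (i + 2) ^ 2 ∈ R (i + 2)) (Q : Ideal (R (i + 2))) (_ : Q.IsPrime) (g : R (i + 2)),
      IsRegularLocalRing (R (i + 2) ⧸ Q) ∧ ringKrullDim (R (i + 2) ⧸ Q) = 2 ∧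
        (⟨s (i + 2) ^ 2, hs⟩ : R (i + 2)) - g ^ 2 ∈ Q ^ 2 := by
  -- DERIVED (strat-2 07:55Z) from the two halves B13a-1′ (decomposition) and B13a-1″ (plane after a switch).
  obtain ⟨hl, hs, hx₁, ρ, G, hρ, hxm, hx2, hf⟩ :=
    hD1 O R P t s hrun i hR hreg hdim (hpt i le_rfl (Nat.le_add_right _ _)) hhigh hhigh' x hx
  exact hD2 O R P t s hrun i hR hreg hdim
    (hpt (i + 1) (Nat.le_succ _) (Nat.succ_le_succ (Nat.le_succ _))) x hx.2.1 hx₁ ρ G ⟨hl, hρ, hxm, hx2⟩ ⟨hs, hf⟩ hsw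

/-- **B13a-2 · NO EQUIMULTIPLE REGULAR PLANE AT A POINT STEP** (OURS, strat-2 07:55Z; sub-stub of B13a, size S; σ_top bookkeeping).
At a point step whose radicand has no singular height-one prime (B4) and whose generic fibre is a field (`hirr`), no prime `Q` with `R/Q`
regular of dimension 2 satisfies `f − g² ∈ Q²`: such a `Q` is singular (criterion: `f ≡ g²` mod `Q²R_Q` makes the embedding dimension of
the radicand ring at `Q` equal to 3 > 2), minimal among singular primes (`⊥` and height one excluded) and of maximal dimension among them
(all have height ≥ 2), hence a TOP component with regular quotient and a global cleaner — σ_top-PERMISSIBLE, contradicting the point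
step (`IsSigmaTopCentre`'s second disjunct). (folklore) -/
def NoEquimultiplePlanePointStepTwo : Prop :=
  ∀ {K : Type} [Field K] [CharP K 2]
    (O : ValuationSubring K) (R : ℕ → Subring K) (P : (i : ℕ) → Ideal (R i)) (t : K) (s : ℕ → K)
    (_hrun : IsSteeredRun O R P t 2 s) (i : ℕ)
    (_hR : ∀ j, ∃ B : Subring K, B ≤ O.toSubring ∧ R j = locAtCentre B O)
    (_hreg : IsRegularLocalRing (R i)) (_hdim : ringKrullDim (R i) = 4)
    (_hirr : ∀ y z : R i, (z : K) ≠ 0 → s i * z ≠ y)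
    (_hpt : IsPointStep R P i) (hs : s i ^ 2 ∈ R i)
    (_hno1 : ∀ (Q : Ideal (R i)) [Q.IsPrime], Q.height = 1 → ¬ IsSingPrime (R i) 2 ⟨s i ^ 2, hs⟩ Q),
    ∀ (Q : Ideal (R i)) [Q.IsPrime] (g : R i), IsRegularLocalRing (R i ⧸ Q) → ringKrullDim (R i ⧸ Q) = 2 →
      (⟨s i ^ 2, hs⟩ : R i) - g ^ 2 ∉ Q ^ 2

/-- **B13a-2 holds** (adoption leaf over res-type-072's LANDED p512361 `NoEquimultiplePlane.not_sub_sq_mem_sq_of_sigmaTop`; 072's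
slot-tested text 08:30:48Z). OURS. [folklore] -/
theorem noEquimultiplePlanePointStepTwo_holds : NoEquimultiplePlanePointStepTwo := by
  intro K _ _ O R P t s hrun i hR hreg hdim hirr hpt hs hno1
  obtain ⟨_, hs', hσ, -, -⟩ := hrun.2 i
  obtain ⟨_, hPi⟩ := hpt
  exact _root_.Summit.ResolutionOfSingularities.ResolutionOfSingularities.Theorems.SwitchingDichotomy.NoEquimultiplePlane.not_sub_sq_mem_sq_of_sigmaTop
    K (R i) hdim ⟨s i ^ 2, hs⟩ (s i) rfl hirr hno1 (P i) hPi hσ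

/-- **B13a · NO SWITCH ON HIGH POINT TAILS** (OURS, strat-2 07:40Z; HIGH regime, one-step, size M). `p = 2`, members regular of
dimension 4, perfect residue fields, generic torsor fibre a field. If stages `i, i+1, i+2, i+3` are POINT steps and the cleaned order
is `≥ 3` at stages `i` and `i+1` (`IsHighOrderAt`), then the exceptional parameter does NOT switch at stage `i+1`: every exceptional
parameter `x` of the point blow-up at stage `i` (an element of `𝔪_i` of maximal value) is still of maximal value in `𝔪_{i+1}`.
PROOF SKETCH. By B1 the cleaned order at `i`, `i+1` is exactly 3. HIGH at `i` gives `f_{i+1} = x·ρ + G₁²` with `ρ, G₁ ∈ R_{i+1}`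
(`(s_i² − ĝ²)/x² ∈ x R_{i+1}`, normality for `G₁ = (ĝ − g)/x`), and HIGH at `i+1` lets one choose `ρ ∈ 𝔪_{i+1}²` (if `ord ρ = 1`
then `in₂(xρ) = in₁(w)²` forces `in₁ρ = λ² in₁x`; absorb `(λx)²` into `G₁²`). Suppose the parameter switches: `v(x) > v(π_{i+1})`.
Then `x' := x/π_{i+1} ∈ 𝔪_{i+2}` and `π_{i+1}, x'` are part of a regular system of parameters of `R_{i+2}` (the plane
`E_{i+2} ∩ E_{i+1}'`), and `f_{i+2} = (f_{i+1} − g₁²)/π_{i+1}² = π_{i+1}·x'·(ρ/π_{i+1}²) + G₃²` with `ρ/π_{i+1}² ∈ R_{i+2}` and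
`G₃ = (G₁ − g₁)/π_{i+1} ∈ R_{i+2}` (normality). Hence `P := (π_{i+1}, x')` is a regular prime with `f_{i+2} − G₃² ∈ P²`: singular and
equimultiple with a GLOBAL cleaner. By B4 (`noHeightOneCarrier_two`, point steps at `i+2, i+3`) there is no singular height-one prime,
and `⊥` is not singular (`hirr`), so `P` is minimal among singular primes and of maximal dimension 2 among them: a TOP component, hence
σ_top-PERMISSIBLE — contradicting the point step at stage `i+2`. (In the (H, Q̃)-game of STRAT2-MEMO-1 §4c this says: only VERTEX steps
`S₂` (directions off the exceptional hyperplane) occur on an eternal high point tail; `S₁` steps are switches.) [folklore] -/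
theorem highPointStep_excParam_persists_two [CharP K 2] (hB4 : NoHeightOneCarrierTwo)
    (hD1 : HighPointStepDecompositionTwo) (hD2 : SwitchPlaneOfDecompositionTwo) (hB13a2 : NoEquimultiplePlanePointStepTwo)
    (O : ValuationSubring K) (R : ℕ → Subring K) (P : (i : ℕ) → Ideal (R i)) (t : K) (s : ℕ → K)
    (hrun : IsSteeredRun O R P t 2 s) (i : ℕ)
    (hR : ∀ j, ∃ B : Subring K, B ≤ O.toSubring ∧ R j = locAtCentre B O)
    (hreg : ∀ j, IsRegularLocalRing (R j)) (hdim : ∀ j, ringKrullDim (R j) = 4)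
    (hperf : ∀ j, ∀ (_ : IsLocalRing (R j)) (a : R j), ∃ b : R j, a - b ^ 2 ∈ IsLocalRing.maximalIdeal (R j))
    (hirr : ∀ j, ∀ y z : R j, (z : K) ≠ 0 → s j * z ≠ y)
    (hpt : ∀ j, i ≤ j → j ≤ i + 3 → IsPointStep R P j)
    (hhigh : IsHighOrderAt R s 2 i) (hhigh' : IsHighOrderAt R s 2 (i + 1)) :
    ∀ x : K, IsExcParamAlong O (R i) (P i) x → IsExcParamAlong O (R (i + 1)) (P (i + 1)) x := by
  intro x hx
  by_contra hsw
  obtain ⟨hs, Q, _, g, hQreg, hQdim, hmem⟩ := switch_plane_two hD1 hD2 O R P t s hrun i hR hreg hdim hirr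
    (fun j hj hj' => hpt j hj (le_trans hj' (Nat.le_succ _))) hhigh hhigh' x hx hsw
  have h2 : IsPointStep R P (i + 2) := hpt (i + 2) (Nat.le_add_right i 2) (Nat.le_succ _)
  have h3 : IsPointStep R P (i + 3) := hpt (i + 3) (Nat.le_add_right i 3) le_rfl
  exact hB13a2 O R P t s hrun (i + 2) hR (hreg _) (hdim _) (hirr _) h2 hs
    (hB4 O R P t s hrun (i + 2) hR (hreg _) (hreg _) (hdim _) (hdim _) hperf hirr h2 h3 hs)
    Q g hQreg hQdim hmem

/-- **B13b · A PERSISTENT EXCEPTIONAL PARAMETER FORCES A DISCRETE VALUATION** (OURS, strat-2 07:40Z; characteristic-free, rank one,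
size S–M). If along a steered run the centres are points from stage `i₀` on and ONE element `x` is an exceptional parameter at every
stage `i ≥ i₀`, and `O` has rank one (`¬ HasProperCoarsening`, `O ≠ ⊤`), then `O` is DISCRETE. PROOF SKETCH. `𝔪_i R_{i+1} = x R_{i+1}`
and every element of `𝔪_{i+1}` has value `≥ v(x)`; for `0 ≠ z ∈ R_{i₀}` divide by `x` while the quotient stays in the maximal ideal —
by the archimedean property this stops, so `v(z) = v(x)^a` with `a ∈ ℕ`. Hence the value group of `Frac(R_{i₀})` is `v(x)^ℤ`, and since
`z ^ p ∈ Frac(R_{i₀})` for every `z ∈ K` (`hK`) the value group of `K` sits in the cyclic group generated by a `p`-th root of `v(x)`, so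
it is cyclic: `Discrete O`. (The known eternal point runs — tri-2's composite-rank class N1 — have a persistent parameter and are
non-discrete exactly because the rank is 2.) [folklore] -/
theorem discrete_of_persistentExcParam
    (O : ValuationSubring K) (R : ℕ → Subring K) (P : (i : ℕ) → Ideal (R i)) (t : K) (p : ℕ) (s : ℕ → K)
    (hrun : IsSteeredRun O R P t p s) (hp : 0 < p) (hO : ¬ HasProperCoarsening O) (hO' : O ≠ ⊤)
    (hR : ∀ j, ∃ B : Subring K, B ≤ O.toSubring ∧ R j = locAtCentre B O)
    (i₀ : ℕ) (x : K) (hx : ∀ i, i₀ ≤ i → IsExcParamAlong O (R i) (P i) x)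
    (hpt : ∀ i, i₀ ≤ i → IsPointStep R P i)
    (hK : ∀ z : K, z ≠ 0 → ∃ a b : R i₀, (a : K) ≠ 0 ∧ (b : K) ≠ 0 ∧ z ^ p * (b : K) = a) :
    Discrete O := by
  -- ADOPTED (strat-2 08:00Z) over res-L0-w41-stub-4's LANDED p510663
  -- `EventualMonomial.discrete_of_persistentExcParam_pointTail` (holder's leaf recipe verbatim).
  refine _root_.Summit.ResolutionOfSingularities.ResolutionOfSingularities.Theorems.SwitchingDichotomy.EventualMonomial.discrete_of_persistentExcParam_pointTail
    O hO' hO R p hp i₀ x hR (fun i hi => ?_) (fun i hi => ?_) hK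
  · obtain ⟨hloc, hs, -, hbl, -⟩ := hrun.2 i
    obtain ⟨hloc', hPi⟩ := hpt i hi
    exact ⟨hloc, by simpa [hPi] using hbl⟩
  · obtain ⟨hloc', hPi⟩ := hpt i hi
    have h := hx i hi
    unfold IsExcParamAlong at h
    rw [hPi] at h
    exact ⟨hloc', h⟩

/-- **B13 · HIGH POINT TAILS FORCE DISCRETENESS** (OURS, strat-2 07:40Z; DERIVED from B13a + B13b by induction along the tail).
`p = 2`, `n = 4`, rank one: an eternal steered run which is eventually a pure point-step run with cleaned order `≥ 3` at every late
stage makes `O` DISCRETE — which `CoreDatum` excludes (`¬ Discrete O`; the discrete case is the landed all-dimension leaf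
`ValuativeLuAlphaPTorsorDiscreteAllDim`). So `PointTailConclTwo ∩ HIGH` holds VACUOUSLY on core data: the (H, Q̃) plane × quadric
game of STRAT2-MEMO-1 §4c never runs for ever in rank one, WITHOUT any analysis of the injected Taylor data — an eternal high point
tail is an eternal sequence of vertex steps, i.e. of NON-switching steps, and a never-switching point sequence of a rank-one valuation
is discrete. What remains of PT₁ is the LOW regime (idea-3 `hyperbolic-splitting-p2` K1 ∧ K2, CJS dim 2). [folklore] -/
theorem pointTailHigh_discrete_two [CharP K 2] (hB4 : NoHeightOneCarrierTwo)
    (hD1 : HighPointStepDecompositionTwo) (hD2 : SwitchPlaneOfDecompositionTwo) (hB13a2 : NoEquimultiplePlanePointStepTwo)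
    (O : ValuationSubring K) (R : ℕ → Subring K) (P : (i : ℕ) → Ideal (R i)) (t : K) (s : ℕ → K)
    (hrun : IsSteeredRun O R P t 2 s) (hO : ¬ HasProperCoarsening O) (hO' : O ≠ ⊤)
    (hR : ∀ j, ∃ B : Subring K, B ≤ O.toSubring ∧ R j = locAtCentre B O)
    (hreg : ∀ j, IsRegularLocalRing (R j)) (hdim : ∀ j, ringKrullDim (R j) = 4)
    (hperf : ∀ j, ∀ (_ : IsLocalRing (R j)) (a : R j), ∃ b : R j, a - b ^ 2 ∈ IsLocalRing.maximalIdeal (R j))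
    (hirr : ∀ j, ∀ y z : R j, (z : K) ≠ 0 → s j * z ≠ y) (i₀ : ℕ)
    (hpt : ∀ i, i₀ ≤ i → IsPointStep R P i) (hhigh : ∀ i, i₀ ≤ i → IsHighOrderAt R s 2 i)
    (hK : ∀ z : K, z ≠ 0 → ∃ a b : R i₀, (a : K) ≠ 0 ∧ (b : K) ≠ 0 ∧ z ^ 2 * (b : K) = a) :
    Discrete O := by
  obtain ⟨_, _, -, -, x, g, hx, -, -⟩ := hrun.2 i₀
  have key : ∀ i, i₀ ≤ i → IsExcParamAlong O (R i) (P i) x := by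
    intro i hi
    induction i, hi using Nat.le_induction with
    | base => exact hx
    | succ j hj ih =>
      exact highPointStep_excParam_persists_two hB4 hD1 hD2 hB13a2 O R P t s hrun j hR hreg hdim hperf hirr
        (fun l hl _ => hpt l (le_trans hj hl)) (hhigh j hj) (hhigh (j + 1) (Nat.le_succ_of_le hj)) x ih
  exact discrete_of_persistentExcParam O R P t 2 s hrun two_pos hO hO' hR i₀ x key hpt hK

/-- **REGENERATION PLUMBING** (OURS, strat-2 08:05Z; PROVED; for the σ_red design question raised by res-L0-w41-tri-3's U7
`t² = (w² + y³)²(1 + x)`): `Concl` is insensitive to replacing the torsor generator `t` by `t' = t·c⁻¹`-type regenerations — if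
`t = t' * c` with `c` in an intermediate finitely generated algebra `A'' ⊇ A₀` inside `O`, then `Concl O A'' t'` gives `Concl O A₀ t`
with the SAME model `A`. So dividing the generator by (a fraction representing) a singular square factor `h` of the radicand costs
nothing on the conclusion side; the content of a reduction move is `Concl` for the square-free part. [folklore] -/
theorem concl_regenerate {k : Type} [Field k] [Algebra k K] (O : ValuationSubring K) (A₀ A'' : Subalgebra k K) (t t' : K)
    (hA : A₀ ≤ A'') (hc : ∃ c ∈ A'', t = t' * c) (h : Concl O A'' t') : Concl O A₀ t := by
  obtain ⟨A, hAO, hA''A, ht', hFG, hFr, hreg⟩ := h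
  obtain ⟨c, hc, rfl⟩ := hc
  exact ⟨A, hAO, le_trans hA hA''A, A.mul_mem ht' (hA''A hc), hFG, hFr, hreg⟩


end SteeredTwo

end Summit.ResolutionOfSingularities.ResolutionOfSingularities.Theorems.SwitchingDichotomy.Words
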